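import Summits.CriticalPhenomena.PercolationContinuityZ3.Theorems.PercNearOneGluingNoHeavyLowerTailKNGoodTwoMarkCells
import HarnessLib

/-!
# `NoHeavyLowerTail` (stmt-CriticalPhenomena-4575) — the two-mark cluster inequality (II) for ALL up-families
# when the second mark cannot meet the sink off the source (prim-hp-2 gen 28, MEMO-gen26 §4 (4g); part 3)

Support file (`--supports stmt-CriticalPhenomena-4575`, hull-port prover `prim-hp-2`, gen 28).  No definitions, no
named facts, no sorries; standard axioms.

Setting: Bernoulli bond percolation with arbitrary edge probabilities `w` on a finite vertex type (`μ = prodBernoulli w`),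
a source `s`, a finite SET of sinks `T` (possibly empty), and two marks `o`, `a`.  Write `R = {s ↮ T}`, `Q = μ(· | R)`,
`C_s` for the open cluster of `s`, `O = {s ~ o}`, `A = {s ~ a}`, `K = {s ↮ a} ∩ R` and `κ = μ(a ~ o | K)`.
The conjectured inequality (II) of MEMO-gen26 §3 (the endpoint of Kozma–Nitzan's box for the cluster-domination form of
their pre-FKG inequality (3) at `|A| = 3`) says `Cov_Q(1_O, U) ≥ κ_M · Cov_Q(1_A, U)` for every increasing `U` of `C_s`.
Parts 1–2 (gen 26) proved it for up-families inside the principal filter `{a ∈ C_s}`.  THIS FILE proves it for EVERY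
up-family `𝒰` of vertex sets under the side condition `μ({a ~ T} ∩ R) = 0` ("`a` cannot reach the sinks off `s`";
then `κ = κ_M`), in particular with NO sink at all (`T = ∅`, Harris' world):

* `KNGoodTwoMark.cov_tilt_of_no_sinkpath` — for every up-family `𝒰` (`E = {C_s ∈ 𝒰}`):
  `μ(R∩O)·μ(R∩E)·μ(K) + μ(K∩{a~o})·μ(R∩A∩E)·μ(R) ≤ μ(R∩O∩E)·μ(R)·μ(K) + μ(K∩{a~o})·μ(R∩A)·μ(R∩E)`,
  i.e. `Q(O ∩ E) − Q(O)Q(E) ≥ κ · (Q(A ∩ E) − Q(A)Q(E))`;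
* `KNGoodTwoMark.cov_tilt_free` — the sink-free case `T = ∅`:
  `μ(O)·μ(E)·μ(K₀) + μ(K₀∩{a~o})·μ(A∩E) ≤ μ(O∩E)·μ(K₀) + μ(K₀∩{a~o})·μ(A)·μ(E)`, `K₀ = {s ↮ a}`, i.e.
  `Cov(1{o ∈ C_s}, U) ≥ μ(o ~ a | a ↮ s) · Cov(1{a ∈ C_s}, U)` — a new (easy) correlation inequality for plain
  percolation: the membership of `o` is at least `κ` times as correlated with every increasing cluster functional as
  the membership of `a`.

Proof (two lines of the paper, MEMO-gen28 §1): with `D = C_a ∪ C_s`, `1{o ∈ C_s} = 1{o ∈ D} − 1_J`,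
`J = {a ~ o} ∩ {s ↮ o}`; (i) set-source BHK for the cluster of `{a,s}` given `{a,s} ↮ T` (= `R` a.e. under the side
condition) makes `{o ∈ D}` positively correlated with `E`; (ii) the two-set BHK inequality (source `{s}`, sinks `{a} ∪ T`)
makes `J` negatively correlated with `E` on `K`; (iii) exact bookkeeping.
[cite: VandenbergHaggstromKahn2005, Thms. 1.1–1.5 (pp. 3–8)] [cite: KozmaNitzan2024, §2.2 Lemmas 1–2 (pp. 5–6), §3 (pp. 7–12)]
-/

noncomputable section

namespace Summit.CriticalPhenomena.PercolationContinuityZ3.Theorems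

open MeasureTheory Set Literature.Probability.LatticeModels Literature.Probability.Percolation
open scoped Classical

namespace KNGoodTwoMark

variable {V : Type*}

/-- `{S ↮ T}` for `S = {a, s}`: both `a` and `s` avoid `T`. [folklore] -/
theorem sep_pair_set_eq (a s : V) (T : Set V) :
    {ω : BondConfig V | ∀ s' ∈ ({a, s} : Set V), ∀ t ∈ T, ¬ (openGraph ω).Reachable s' t} =
      {ω | (∀ t ∈ T, ¬ (openGraph ω).Reachable a t) ∧ ∀ t ∈ T, ¬ (openGraph ω).Reachable s t} := by
  ext ω
  simp only [Set.mem_setOf_eq, Set.mem_insert_iff, Set.mem_singleton_iff, forall_eq_or_imp, forall_eq]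

/-- `{S ↮ T'}` for `S = {s}`, `T' = {a} ∪ T`. [folklore] -/
theorem sep_single_set_eq (a s : V) (T : Set V) :
    {ω : BondConfig V | ∀ s' ∈ ({s} : Set V), ∀ t ∈ ({a} : Set V) ∪ T, ¬ (openGraph ω).Reachable s' t} =
      {ω | ¬ (openGraph ω).Reachable s a ∧ ∀ t ∈ T, ¬ (openGraph ω).Reachable s t} := by
  ext ω
  simp only [Set.mem_setOf_eq, Set.mem_singleton_iff, Set.mem_union, forall_eq]
  constructor
  · intro h
    exact ⟨h a (Or.inl rfl), fun t ht => h t (Or.inr ht)⟩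
  · rintro ⟨h1, h2⟩ t (rfl | ht)
    · exact h1
    · exact h2 t ht

variable [Fintype V]

/-- **Set-source BHK step, source `{a,s}`, sink set `T`**: for an up-family `𝒰`, with
`D = {a ↮ T} ∩ {s ↮ T}`, `OD = {a~o} ∪ {s~o}`, `E = {C_s ∈ 𝒰}`:  `μ(D ∩ OD)·μ(D ∩ E) ≤ μ(D)·μ(D ∩ OD ∩ E)`.
[cite: VandenbergHaggstromKahn2005, Thm. 1.2 with Remark 1 (p. 5)] -/
theorem bhk_pair_upfamily_set (w : Sym2 V → unitInterval) (o a s : V) (T : Set V) (𝒰 : Set (Set V))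
    (hU : ∀ W ∈ 𝒰, ∀ W' : Set V, W ⊆ W' → W' ∈ 𝒰) :
    (prodBernoulli w).real ({ω : BondConfig V | (∀ t ∈ T, ¬ (openGraph ω).Reachable a t) ∧
          ∀ t ∈ T, ¬ (openGraph ω).Reachable s t} ∩
        {ω | (openGraph ω).Reachable a o ∨ (openGraph ω).Reachable s o}) *
      (prodBernoulli w).real ({ω : BondConfig V | (∀ t ∈ T, ¬ (openGraph ω).Reachable a t) ∧
          ∀ t ∈ T, ¬ (openGraph ω).Reachable s t} ∩
        {ω | {v | (openGraph ω).Reachable s v} ∈ 𝒰}) ≤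
    (prodBernoulli w).real {ω : BondConfig V | (∀ t ∈ T, ¬ (openGraph ω).Reachable a t) ∧
          ∀ t ∈ T, ¬ (openGraph ω).Reachable s t} *
      (prodBernoulli w).real ({ω : BondConfig V | (∀ t ∈ T, ¬ (openGraph ω).Reachable a t) ∧
          ∀ t ∈ T, ¬ (openGraph ω).Reachable s t} ∩
        ({ω | (openGraph ω).Reachable a o ∨ (openGraph ω).Reachable s o} ∩
         {ω | {v | (openGraph ω).Reachable s v} ∈ 𝒰})) := by
  have hs : s ∈ ({a, s} : Set V) := by simp
  have key := KNSep.bhk_set_event_pos w ({a, s} : Set V) T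
    (fun C _ => ∃ s' ∈ ({a, s} : Set V), (openGraph C).Reachable s' o)
    (fun C _ => {v | (openGraph C).Reachable s v} ∈ 𝒰)
    (fun D C C' hCC' h => by
      obtain ⟨s', hs', hso⟩ := h
      exact ⟨s', hs', hso.mono (openGraph_mono hCC')⟩)
    (fun C D D' hDD' h => h)
    (fun D C C' hCC' h => hU _ h _ (fun v hv => SimpleGraph.Reachable.mono (openGraph_mono hCC') hv))
    (fun C D D' hDD' h => h)
  have hP : {ω : BondConfig V | ∃ s' ∈ ({a, s} : Set V),
        (openGraph (⋃ t ∈ ({a, s} : Set V), openEdgeCluster ω t)).Reachable s' o} =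
      {ω | (openGraph ω).Reachable a o ∨ (openGraph ω).Reachable s o} := by
    rw [← conn_pair_eq a s o]
    ext ω; exact (KNLemma2.conn_iff_cluster ω ({a, s} : Set V) o).symm
  have hQ : {ω : BondConfig V | {v | (openGraph (⋃ t ∈ ({a, s} : Set V), openEdgeCluster ω t)).Reachable s v} ∈ 𝒰} =
      {ω | {v | (openGraph ω).Reachable s v} ∈ 𝒰} := by
    ext ω
    have : {v | (openGraph (⋃ t ∈ ({a, s} : Set V), openEdgeCluster ω t)).Reachable s v} =
        {v | (openGraph ω).Reachable s v} := by
      ext v; exact (KNSep.reachable_iff_cluster ω ({a, s} : Set V) hs v).symm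
    simp only [Set.mem_setOf_eq, this]
  rw [sep_pair_set_eq] at key
  simp only [hP, hQ] at key
  exact key

/-- **Two-set BHK step, source `{s}`, sinks `{a} ∪ T`** (negative correlation of the two clusters): with
`K = {s ↮ a} ∩ {s ↮ T}`, `E = {C_s ∈ 𝒰}` (`𝒰` an up-family) and the event `{a ~ o}` (increasing in the cluster of
`{a} ∪ T`):  `μ(K)·μ(K ∩ E ∩ {a~o}) ≤ μ(K ∩ E)·μ(K ∩ {a~o})`.
[cite: VandenbergHaggstromKahn2005, Thm. 1.3 (p. 6)] -/
theorem bhk_single_neg_set (w : Sym2 V → unitInterval) (o a s : V) (T : Set V) (𝒰 : Set (Set V))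
    (hU : ∀ W ∈ 𝒰, ∀ W' : Set V, W ⊆ W' → W' ∈ 𝒰) :
    (prodBernoulli w).real {ω : BondConfig V | ¬ (openGraph ω).Reachable s a ∧
          ∀ t ∈ T, ¬ (openGraph ω).Reachable s t} *
      (prodBernoulli w).real ({ω : BondConfig V | ¬ (openGraph ω).Reachable s a ∧
          ∀ t ∈ T, ¬ (openGraph ω).Reachable s t} ∩
        ({ω | {v | (openGraph ω).Reachable s v} ∈ 𝒰} ∩ {ω | (openGraph ω).Reachable a o})) ≤
    (prodBernoulli w).real ({ω : BondConfig V | ¬ (openGraph ω).Reachable s a ∧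
          ∀ t ∈ T, ¬ (openGraph ω).Reachable s t} ∩
        {ω | {v | (openGraph ω).Reachable s v} ∈ 𝒰}) *
      (prodBernoulli w).real ({ω : BondConfig V | ¬ (openGraph ω).Reachable s a ∧
          ∀ t ∈ T, ¬ (openGraph ω).Reachable s t} ∩
        {ω | (openGraph ω).Reachable a o}) := by
  have hs : s ∈ ({s} : Set V) := by simp
  have ha : a ∈ ({a} : Set V) ∪ T := by simp
  have key := KNSep.bhk_set_event_neg w ({s} : Set V) (({a} : Set V) ∪ T)
    (fun C _ => {v | (openGraph C).Reachable s v} ∈ 𝒰)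
    (fun _ D => (openGraph D).Reachable a o)
    (fun D C C' hCC' h => hU _ h _ (fun v hv => SimpleGraph.Reachable.mono (openGraph_mono hCC') hv))
    (fun C D D' hDD' h => h)
    (fun D C C' hCC' h => h)
    (fun C D D' hDD' h => h.mono (openGraph_mono hDD'))
  have hP : {ω : BondConfig V | {v | (openGraph (⋃ t ∈ ({s} : Set V), openEdgeCluster ω t)).Reachable s v} ∈ 𝒰} =
      {ω | {v | (openGraph ω).Reachable s v} ∈ 𝒰} := by
    ext ω
    have : {v | (openGraph (⋃ t ∈ ({s} : Set V), openEdgeCluster ω t)).Reachable s v} =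
        {v | (openGraph ω).Reachable s v} := by
      ext v; exact (KNSep.reachable_iff_cluster ω ({s} : Set V) hs v).symm
    simp only [Set.mem_setOf_eq, this]
  have hQ : {ω : BondConfig V | (openGraph (⋃ t ∈ ({a} : Set V) ∪ T, openEdgeCluster ω t)).Reachable a o} =
      {ω | (openGraph ω).Reachable a o} := by
    ext ω
    exact (KNSep.reachable_iff_cluster ω (({a} : Set V) ∪ T) ha o).symm
  rw [sep_single_set_eq] at key
  simp only [hP, hQ] at key
  exact key

/-- **(II) for every up-family when `a` cannot reach the sinks off `s`** (MEMO-gen26 §4 (4g); denominator-free).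
With `R = {s ↮ T}`, `K = {s ↮ a} ∩ R`, `O = {s ~ o}`, `A = {s ~ a}`, `E = {C_s ∈ 𝒰}` (`𝒰` any up-family of vertex
sets) and the side condition `μ({a ~ T} ∩ R) = 0`:
`μ(R∩O)·μ(R∩E)·μ(K) + μ(K∩{a~o})·μ(R∩A∩E)·μ(R) ≤ μ(R∩O∩E)·μ(R)·μ(K) + μ(K∩{a~o})·μ(R∩A)·μ(R∩E)`,
i.e. `Cov_Q(1{o ∈ C_s}, 1_E) ≥ μ(a ~ o | K) · Cov_Q(1{a ∈ C_s}, 1_E)` for `Q = μ(· | R)`; under the side condition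
`μ(a ~ o | K) = κ_M = μ(a ~ o | a, s, T pairwise separated)`.
[cite: VandenbergHaggstromKahn2005, Thms. 1.2–1.3 (pp. 5–6)] [cite: KozmaNitzan2024, Lemmas 1–2 (pp. 5–6)] -/
theorem cov_tilt_of_no_sinkpath (w : Sym2 V → unitInterval) (o a s : V) (T : Set V) (𝒰 : Set (Set V))
    (hU : ∀ W ∈ 𝒰, ∀ W' : Set V, W ⊆ W' → W' ∈ 𝒰)
    (hax : (prodBernoulli w).real {ω : BondConfig V | (∃ t ∈ T, (openGraph ω).Reachable a t) ∧
        ∀ t ∈ T, ¬ (openGraph ω).Reachable s t} = 0) :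
    (prodBernoulli w).real ({ω : BondConfig V | ∀ t ∈ T, ¬ (openGraph ω).Reachable s t} ∩
          {ω | (openGraph ω).Reachable s o}) *
        (prodBernoulli w).real ({ω : BondConfig V | ∀ t ∈ T, ¬ (openGraph ω).Reachable s t} ∩
          {ω | {v | (openGraph ω).Reachable s v} ∈ 𝒰}) *
        (prodBernoulli w).real {ω : BondConfig V | ¬ (openGraph ω).Reachable s a ∧
          ∀ t ∈ T, ¬ (openGraph ω).Reachable s t} +
      (prodBernoulli w).real ({ω : BondConfig V | ¬ (openGraph ω).Reachable s a ∧
            ∀ t ∈ T, ¬ (openGraph ω).Reachable s t} ∩ {ω | (openGraph ω).Reachable a o}) *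
        (prodBernoulli w).real ({ω : BondConfig V | ∀ t ∈ T, ¬ (openGraph ω).Reachable s t} ∩
          ({ω | (openGraph ω).Reachable s a} ∩ {ω | {v | (openGraph ω).Reachable s v} ∈ 𝒰})) *
        (prodBernoulli w).real {ω : BondConfig V | ∀ t ∈ T, ¬ (openGraph ω).Reachable s t} ≤
    (prodBernoulli w).real ({ω : BondConfig V | ∀ t ∈ T, ¬ (openGraph ω).Reachable s t} ∩
          ({ω | (openGraph ω).Reachable s o} ∩ {ω | {v | (openGraph ω).Reachable s v} ∈ 𝒰})) *
        (prodBernoulli w).real {ω : BondConfig V | ∀ t ∈ T, ¬ (openGraph ω).Reachable s t} *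
        (prodBernoulli w).real {ω : BondConfig V | ¬ (openGraph ω).Reachable s a ∧
          ∀ t ∈ T, ¬ (openGraph ω).Reachable s t} +
      (prodBernoulli w).real ({ω : BondConfig V | ¬ (openGraph ω).Reachable s a ∧
            ∀ t ∈ T, ¬ (openGraph ω).Reachable s t} ∩ {ω | (openGraph ω).Reachable a o}) *
        (prodBernoulli w).real ({ω : BondConfig V | ∀ t ∈ T, ¬ (openGraph ω).Reachable s t} ∩
          {ω | (openGraph ω).Reachable s a}) *
        (prodBernoulli w).real ({ω : BondConfig V | ∀ t ∈ T, ¬ (openGraph ω).Reachable s t} ∩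
          {ω | {v | (openGraph ω).Reachable s v} ∈ 𝒰}) := by
  set μ := prodBernoulli w with hμ
  -- events
  set R : Set (BondConfig V) := {ω | ∀ t ∈ T, ¬ (openGraph ω).Reachable s t} with hR
  set D : Set (BondConfig V) := {ω | (∀ t ∈ T, ¬ (openGraph ω).Reachable a t) ∧
      ∀ t ∈ T, ¬ (openGraph ω).Reachable s t} with hD
  set K : Set (BondConfig V) := {ω | ¬ (openGraph ω).Reachable s a ∧
      ∀ t ∈ T, ¬ (openGraph ω).Reachable s t} with hK
  set O : Set (BondConfig V) := {ω | (openGraph ω).Reachable s o} with hO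
  set A : Set (BondConfig V) := {ω | (openGraph ω).Reachable s a} with hA
  set OD : Set (BondConfig V) := {ω | (openGraph ω).Reachable a o ∨ (openGraph ω).Reachable s o} with hOD
  set E : Set (BondConfig V) := {ω | {v | (openGraph ω).Reachable s v} ∈ 𝒰} with hE
  set Jo : Set (BondConfig V) := {ω | (openGraph ω).Reachable a o} with hJo
  set X : Set (BondConfig V) := {ω | (∃ t ∈ T, (openGraph ω).Reachable a t) ∧
      ∀ t ∈ T, ¬ (openGraph ω).Reachable s t} with hX
  -- (i) set-source BHK and (ii) two-set BHK
  have h1 := bhk_pair_upfamily_set w o a s T 𝒰 hU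
  have h2 := bhk_single_neg_set w o a s T 𝒰 hU
  simp only [← hμ] at h1 h2
  change μ.real (D ∩ OD) * μ.real (D ∩ E) ≤ μ.real D * μ.real (D ∩ (OD ∩ E)) at h1
  change μ.real K * μ.real (K ∩ (E ∩ Jo)) ≤ μ.real (K ∩ E) * μ.real (K ∩ Jo) at h2
  -- a.e. replacement of `D` by `R` under the side condition
  have hDR : D ⊆ R := fun ω hω => hω.2
  have hRDX : ∀ Y : Set (BondConfig V), R ∩ Y ⊆ D ∩ Y ∪ X := by
    intro Y ω hω
    by_cases h : ∃ t ∈ T, (openGraph ω).Reachable a t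
    · exact Or.inr ⟨h, hω.1⟩
    · push Not at h
      exact Or.inl ⟨⟨h, hω.1⟩, hω.2⟩
  have hX0 : μ.real X = 0 := hax
  have hDRY : ∀ Y : Set (BondConfig V), μ.real (D ∩ Y) = μ.real (R ∩ Y) := by
    intro Y
    apply le_antisymm
    · exact measureReal_mono (Set.inter_subset_inter_left Y hDR)
    · calc μ.real (R ∩ Y) ≤ μ.real (D ∩ Y ∪ X) := measureReal_mono (hRDX Y)
        _ ≤ μ.real (D ∩ Y) + μ.real X := measureReal_union_le _ _
        _ = μ.real (D ∩ Y) := by rw [hX0, add_zero]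
  have hDR' : μ.real D = μ.real R := by
    have := hDRY Set.univ
    simpa only [Set.inter_univ] using this
  rw [hDRY, hDRY, hDR', hDRY] at h1
  -- (iii) decompositions: `R ∩ OD = (R ∩ O) ⊔ (K ∩ Jo)` (also after intersecting with `E`), `R = (R ∩ A) ⊔ K`
  have hdisj1 : Disjoint (R ∩ O) (K ∩ Jo) := by
    rw [Set.disjoint_left]
    rintro ω ⟨-, hso⟩ ⟨⟨hsa, -⟩, hao⟩
    exact hsa (hso.trans hao.symm)
  have hsplit1 : R ∩ OD = (R ∩ O) ∪ (K ∩ Jo) := by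
    ext ω
    constructor
    · rintro ⟨hR', hod⟩
      by_cases hso : (openGraph ω).Reachable s o
      · exact Or.inl ⟨hR', hso⟩
      · rcases hod with hao | hso'
        · refine Or.inr ⟨⟨fun hsa => hso (hsa.trans hao), hR'⟩, hao⟩
        · exact absurd hso' hso
    · rintro (⟨hR', hso⟩ | ⟨⟨-, hR'⟩, hao⟩)
      · exact ⟨hR', Or.inr hso⟩
      · exact ⟨hR', Or.inl hao⟩
  have hsplit1E : R ∩ (OD ∩ E) = (R ∩ (O ∩ E)) ∪ (K ∩ (E ∩ Jo)) := by
    ext ω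
    constructor
    · rintro ⟨hR', hod, he⟩
      have : ω ∈ R ∩ OD := ⟨hR', hod⟩
      rw [hsplit1] at this
      rcases this with ⟨hR'', hso⟩ | ⟨hk, hao⟩
      · exact Or.inl ⟨hR'', hso, he⟩
      · exact Or.inr ⟨hk, he, hao⟩
    · rintro (⟨hR', hso, he⟩ | ⟨hk, he, hao⟩)
      · exact ⟨hR', Or.inr hso, he⟩
      · exact ⟨hk.2, Or.inl hao, he⟩
  have hdisj1E : Disjoint (R ∩ (O ∩ E)) (K ∩ (E ∩ Jo)) := by
    refine Set.disjoint_of_subset ?_ ?_ hdisj1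
    · exact fun ω hω => ⟨hω.1, hω.2.1⟩
    · exact fun ω hω => ⟨hω.1, hω.2.2⟩
  have hm1 : μ.real (R ∩ OD) = μ.real (R ∩ O) + μ.real (K ∩ Jo) := by
    rw [hsplit1, measureReal_union hdisj1 MeasurableSet.of_discrete]
  have hm1E : μ.real (R ∩ (OD ∩ E)) = μ.real (R ∩ (O ∩ E)) + μ.real (K ∩ (E ∩ Jo)) := by
    rw [hsplit1E, measureReal_union hdisj1E MeasurableSet.of_discrete]
  have hsplit2 : ∀ Y : Set (BondConfig V), μ.real (R ∩ Y) = μ.real (R ∩ (A ∩ Y)) + μ.real (K ∩ Y) := by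
    intro Y
    have hd : Disjoint (R ∩ (A ∩ Y)) (K ∩ Y) := by
      rw [Set.disjoint_left]
      rintro ω ⟨-, hsa, -⟩ ⟨⟨hsa', -⟩, -⟩
      exact hsa' hsa
    have hu : R ∩ Y = (R ∩ (A ∩ Y)) ∪ (K ∩ Y) := by
      ext ω
      constructor
      · rintro ⟨hR', hy⟩
        by_cases hsa : (openGraph ω).Reachable s a
        · exact Or.inl ⟨hR', hsa, hy⟩
        · exact Or.inr ⟨⟨hsa, hR'⟩, hy⟩
      · rintro (⟨hR', -, hy⟩ | ⟨⟨-, hR'⟩, hy⟩)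
        · exact ⟨hR', hy⟩
        · exact ⟨hR', hy⟩
    rw [hu, measureReal_union hd MeasurableSet.of_discrete]
  have h3 := hsplit2 Set.univ
  simp only [Set.inter_univ] at h3
  have h4 := hsplit2 E
  rw [hm1, hm1E] at h1
  -- (iv) bookkeeping
  have hk : 0 ≤ μ.real K := measureReal_nonneg
  have hr : 0 ≤ μ.real R := measureReal_nonneg
  have hkJ : 0 ≤ μ.real (K ∩ Jo) := measureReal_nonneg
  have hrE : 0 ≤ μ.real (R ∩ E) := measureReal_nonneg
  nlinarith [mul_le_mul_of_nonneg_left h1 hk, mul_le_mul_of_nonneg_left h2 hr, h3, h4,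
    mul_nonneg hkJ hrE, mul_nonneg hkJ hr]

/-- **(II) with no sink** (the case `T = ∅` of `cov_tilt_of_no_sinkpath`; plain percolation, no side condition): with
`K₀ = {s ↮ a}`, `O = {s ~ o}`, `A = {s ~ a}`, `E = {C_s ∈ 𝒰}` for any up-family `𝒰` of vertex sets,
`μ(O)·μ(E)·μ(K₀) + μ(K₀∩{a~o})·μ(A∩E) ≤ μ(O∩E)·μ(K₀) + μ(K₀∩{a~o})·μ(A)·μ(E)`, i.e.
`Cov(1{o ∈ C_s}, 1_E) ≥ μ(a ~ o | a ↮ s) · Cov(1{a ∈ C_s}, 1_E)`: the membership of `o` in the cluster of `s` is at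
least `κ = μ(a ~ o | a ↮ s)` times as positively correlated with every increasing cluster event as the membership of `a`
(`κ` is sharp: a leaf `o` hung on `a` with weight `κ` gives equality for every `E` blind to `o`).
[cite: VandenbergHaggstromKahn2005, Thm. 1.3 (p. 6)] [cite: KozmaNitzan2024, Lemmas 1–2 (pp. 5–6)] -/
theorem cov_tilt_free (w : Sym2 V → unitInterval) (o a s : V) (𝒰 : Set (Set V))
    (hU : ∀ W ∈ 𝒰, ∀ W' : Set V, W ⊆ W' → W' ∈ 𝒰) :
    (prodBernoulli w).real {ω : BondConfig V | (openGraph ω).Reachable s o} *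
        (prodBernoulli w).real {ω : BondConfig V | {v | (openGraph ω).Reachable s v} ∈ 𝒰} *
        (prodBernoulli w).real {ω : BondConfig V | ¬ (openGraph ω).Reachable s a} +
      (prodBernoulli w).real ({ω : BondConfig V | ¬ (openGraph ω).Reachable s a} ∩
          {ω | (openGraph ω).Reachable a o}) *
        (prodBernoulli w).real ({ω : BondConfig V | (openGraph ω).Reachable s a} ∩
          {ω | {v | (openGraph ω).Reachable s v} ∈ 𝒰}) ≤
    (prodBernoulli w).real ({ω : BondConfig V | (openGraph ω).Reachable s o} ∩
          {ω | {v | (openGraph ω).Reachable s v} ∈ 𝒰}) *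
        (prodBernoulli w).real {ω : BondConfig V | ¬ (openGraph ω).Reachable s a} +
      (prodBernoulli w).real ({ω : BondConfig V | ¬ (openGraph ω).Reachable s a} ∩
          {ω | (openGraph ω).Reachable a o}) *
        (prodBernoulli w).real {ω : BondConfig V | (openGraph ω).Reachable s a} *
        (prodBernoulli w).real {ω : BondConfig V | {v | (openGraph ω).Reachable s v} ∈ 𝒰} := by
  have key := cov_tilt_of_no_sinkpath w o a s (∅ : Set V) 𝒰 hU (by simp)
  have hR : {ω : BondConfig V | ∀ t ∈ (∅ : Set V), ¬ (openGraph ω).Reachable s t} = Set.univ := by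
    ext ω; simp
  have hK : {ω : BondConfig V | ¬ (openGraph ω).Reachable s a ∧ ∀ t ∈ (∅ : Set V), ¬ (openGraph ω).Reachable s t} =
      {ω | ¬ (openGraph ω).Reachable s a} := by
    ext ω; simp
  simp only [hR, hK, Set.univ_inter, probReal_univ, mul_one] at key
  simpa only [Set.inter_comm, Set.inter_left_comm, Set.inter_assoc, mul_comm, mul_left_comm, mul_assoc] using key

end KNGoodTwoMark

end Summit.CriticalPhenomena.PercolationContinuityZ3.Theorems
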